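import Summits.AtomisticToContinuum.HydrodynamicLimit.Theses.InformationPercolationEngine
import Literature.MathematicalPhysics.KineticTheory.VelocityBlindPlacement

/-!
# Negative-lane helpers for crux `PercolationClosesChaos` (stmt-AtomisticToContinuum-14915, rev 4):
typed-object audit of the line `Sketch` (docking A, velocity-blind placement)

Kernel-checked shadows behind findings F14/F15 of the standing disproof record
(`Cruxes/PercolationClosesChaos/Disproof.lean`, cycle 4, §10) of the crux
`PercolationClosesChaos : KickFairRelEquilibrium → SpectralContractionR → ContactChaos`
(route InformationPercolationEngine), stated on the LANDED vocabulary of the line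
(`Literature.MathematicalPhysics.KineticTheory.VelocityBlindPlacement`: `meanFreePath`, `bump`, `closeStat`, `allStat`,
`vbpDefect`, `poolMass/Momentum/Energy/Velocity/Temperature`, `maxwellDefect`), i.e. on the objects of the three
registered stubs `stub_velocityBlindPlacement`, `stub_localMaxwellian`, `stub_subMeanFreeTimeWindow` of
`Cruxes/PercolationClosesChaos/Lines/Sketch.lean`. No statement of the route is asserted here, positively or negatively;
the lead, ideators and planners may import the lemmas.

* `card_mul_meanFreePath_cube`: `(N+1) · ℓ_N³ = (π³ σ⁶)⁻¹` — at fixed reduced density the number of particles in a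
  mean-free-path cube is `N`-independent (`ℓ_N = (π (N+1) ε_N²)⁻¹`, `ε_N = σ (N+1)^{-1/3}`), so the normalisation
  `((N+1) ℓ³)^k` of `closeStat` is the right one and an `ℓ`-ball holds `≈ 0.135 ρ σ⁻⁶` particles.
* `closeStat_const`, `allStat_const`, `vbpDefect_const`: for a CONSTANT label test the velocity-blind-placement
  cross-ratio defect vanishes identically, for every configuration, flow, geometry test, localiser and order `k` —
  the typed hypothesis VBP constrains the label law GIVEN the empirical placement geometry and never the geometry
  marginal `Close_{g,1}` itself (finding F15 d1: the window transfer `stub_subMeanFreeTimeWindow` evaluates that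
  marginal against the hard-core-uniform reference, which no registered hypothesis supplies).
* `bump_nonneg`, `norm_sum_smul_sq_le` (weighted Cauchy–Schwarz `‖Σ bᵢ vᵢ‖² ≤ (Σ bᵢ)(Σ bᵢ‖vᵢ‖²)`),
  `poolTemperature_nonneg`: the `r`-pool temperature fed to the Maxwellian of `maxwellDefect` is never negative
  (`r > 0`); `localMaxwellian_one_zero`: at `θ = 0` (empty or cold pool) that Maxwellian is the junk value `0`, not a
  Dirac mass — harmless in the typed order (`r` fixed, `N → ∞`), a trap for `r_N → 0` re-typings.
-/

namespace Summit.AtomisticToContinuum.HydrodynamicLimit.Theorems.PercolationClosesChaos.Negative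

open MeasureTheory Set
open scoped BigOperators
open Literature.Analysis.FluidPDE Literature.MathematicalPhysics.KineticTheory
open Literature.MathematicalPhysics.KineticTheory.VelocityBlindPlacement

/-! ## Normalisation of the close statistic -/

/-- **`(N+1) · ℓ_N³ = (π³ σ⁶)⁻¹`**: the number of particles in a mean-free-path cube is `N`-independent at fixed
reduced density (`ℓ_N = (π (N+1) ε_N²)⁻¹`, `ε_N = σ (N+1)^{-1/3}`, so `ℓ_N = (π σ²)⁻¹ (N+1)^{-1/3}`). [folklore] -/
theorem card_mul_meanFreePath_cube (σ : ℝ) (N : ℕ) :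
    ((N : ℝ) + 1) * meanFreePath σ N ^ 3 = (Real.pi ^ 3 * σ ^ 6)⁻¹ := by
  set M : ℝ := ((N + 1 : ℕ) : ℝ) with hM
  have hMpos : 0 < M := by rw [hM]; positivity
  have hM' : ((N : ℝ) + 1) = M := by rw [hM]; push_cast; ring
  set c : ℝ := M ^ (-(1 / 3 : ℝ)) with hc
  have hc3 : c ^ 3 = M⁻¹ := by
    rw [hc, ← Real.rpow_natCast, ← Real.rpow_mul hMpos.le]
    norm_num
    exact Real.rpow_neg_one M
  have hdiam : hsDiameter σ N = σ * c := by rw [hsDiameter, hc, hM]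
  have hcube : (Real.pi * M * (σ * c) ^ 2) ^ 3 = Real.pi ^ 3 * σ ^ 6 * M := by
    have : (Real.pi * M * (σ * c) ^ 2) ^ 3 = Real.pi ^ 3 * σ ^ 6 * (M ^ 3 * (c ^ 3) ^ 2) := by ring
    rw [this, hc3]
    field_simp
  unfold meanFreePath
  rw [hM', hdiam, inv_pow, hcube]
  field_simp

/-! ## VBP is void on the placement marginal -/

variable {k N : ℕ}

/-- A constant label test factors out of the close statistic. [folklore] -/
theorem closeStat_const (g : (Fin k → V3) → ℝ) (c σ r : ℝ) (z : Phase N) (x₀ : T3) :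
    closeStat k g (fun _ => c) σ r N z x₀ = c * closeStat k g (fun _ => 1) σ r N z x₀ := by
  simp only [closeStat, mul_one, ← Finset.sum_mul]
  ring

/-- A constant label test factors out of the product statistic. [folklore] -/
theorem allStat_const (c r : ℝ) (z : Phase N) (x₀ : T3) :
    allStat k (fun _ => c) r N z x₀ = c * allStat k (fun _ => 1) r N z x₀ := by
  simp only [allStat, mul_one, ← Finset.sum_mul]
  ring

/-- **VBP is void on the placement marginal**: for a CONSTANT label test the cross-ratio defect `vbpDefect` vanishes
identically — for every configuration `z`, geometry test `g`, flow `Φ`, localiser `χ`, order `k` and all parameters.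
Hence the conclusion of `stub_velocityBlindPlacement` / first hypothesis of `stub_subMeanFreeTimeWindow` never constrains
the empirical placement geometry `closeStat k g (fun _ => 1)`, which the window transfer evaluates against the
hard-core-uniform reference (Disproof.lean F15 d1). [folklore] -/
theorem vbpDefect_const (g : (Fin k → V3) → ℝ) (c σ τ r : ℝ) (Φ : Flow σ N) (χ : ℝ × T3 → ℝ) (z : Phase N) :
    vbpDefect k g (fun _ => c) σ τ r N Φ χ z = 0 := by
  have h : ∀ (w : Phase N) (x₀ : T3),
      closeStat k g (fun _ => c) σ r N w x₀ * allStat k (fun _ => 1) r N w x₀ -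
        closeStat k g (fun _ => 1) σ r N w x₀ * allStat k (fun _ => c) r N w x₀ = 0 := by
    intro w x₀
    rw [closeStat_const g c, allStat_const c]
    ring
  unfold vbpDefect
  simp_rw [h]
  simp

/-! ## The `r`-pool temperature is never negative; the cold-pool Maxwellian is the junk value `0` -/

/-- The target's bump `b_r` is non-negative for `r > 0` (for `r < 0` it is not: `3/(π r³) < 0`). [folklore] -/
theorem bump_nonneg {r : ℝ} (hr : 0 < r) (x y : T3) : 0 ≤ bump r x y := by
  unfold bump
  have : 0 ≤ 3 / (Real.pi * r ^ 3) := by positivity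
  exact mul_nonneg this (le_max_right _ _)

/-- Weighted Cauchy–Schwarz for vectors: `‖Σ bᵢ vᵢ‖² ≤ (Σ bᵢ)(Σ bᵢ ‖vᵢ‖²)` for weights `b ≥ 0`. [folklore] -/
theorem norm_sum_smul_sq_le {ι : Type*} (s : Finset ι) (b : ι → ℝ) (hb : ∀ i ∈ s, 0 ≤ b i) (v : ι → V3) :
    ‖∑ i ∈ s, b i • v i‖ ^ 2 ≤ (∑ i ∈ s, b i) * ∑ i ∈ s, b i * ‖v i‖ ^ 2 := by
  have h1 : ‖∑ i ∈ s, b i • v i‖ ≤ ∑ i ∈ s, Real.sqrt (b i) * (Real.sqrt (b i) * ‖v i‖) := by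
    refine (norm_sum_le _ _).trans (le_of_eq (Finset.sum_congr rfl fun i hi => ?_))
    rw [norm_smul, Real.norm_eq_abs, abs_of_nonneg (hb i hi), ← mul_assoc, Real.mul_self_sqrt (hb i hi)]
  have h2 := Finset.sum_mul_sq_le_sq_mul_sq s (fun i => Real.sqrt (b i)) (fun i => Real.sqrt (b i) * ‖v i‖)
  have h3 : ∑ i ∈ s, Real.sqrt (b i) ^ 2 = ∑ i ∈ s, b i :=
    Finset.sum_congr rfl fun i hi => Real.sq_sqrt (hb i hi)
  have h4 : ∑ i ∈ s, (Real.sqrt (b i) * ‖v i‖) ^ 2 = ∑ i ∈ s, b i * ‖v i‖ ^ 2 :=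
    Finset.sum_congr rfl fun i hi => by rw [mul_pow, Real.sq_sqrt (hb i hi)]
  rw [h3, h4] at h2
  have h0 : 0 ≤ ‖∑ i ∈ s, b i • v i‖ := norm_nonneg _
  calc ‖∑ i ∈ s, b i • v i‖ ^ 2 ≤ (∑ i ∈ s, Real.sqrt (b i) * (Real.sqrt (b i) * ‖v i‖)) ^ 2 :=
        pow_le_pow_left₀ h0 h1 2
    _ ≤ _ := h2

/-- **No junk-negative temperature**: for `r > 0` the `r`-pool temperature `θ = (2/3)(e/ρ − |u|²/2)` fed to the
Maxwellian of `maxwellDefect` is `≥ 0` for every configuration (`= 0` exactly for an empty or a cold pool: the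
weighted Cauchy–Schwarz inequality `|m|² ≤ 2 e ρ` for the bump-weighted empirical measure). [folklore] -/
theorem poolTemperature_nonneg {r : ℝ} (hr : 0 < r) (z : Phase N) (x₀ : T3) : 0 ≤ poolTemperature r N z x₀ := by
  unfold poolTemperature poolVelocity poolEnergy poolMass poolMomentum
  set c : ℝ := (((N : ℝ) + 1))⁻¹ with hc
  have hcpos : 0 < c := by rw [hc]; positivity
  set B : ℝ := ∑ i : Fin (N + 1), bump r (z i).1 x₀ with hB
  set E : ℝ := ∑ i : Fin (N + 1), bump r (z i).1 x₀ * (‖(z i).2‖ ^ 2 / 2) with hE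
  set P : V3 := ∑ i : Fin (N + 1), bump r (z i).1 x₀ • (z i).2 with hP
  have hb : ∀ i ∈ (Finset.univ : Finset (Fin (N + 1))), 0 ≤ bump r (z i).1 x₀ := fun i _ => bump_nonneg hr _ _
  have hBnn : 0 ≤ B := Finset.sum_nonneg hb
  have hCS : ‖P‖ ^ 2 ≤ B * (2 * E) := by
    have := norm_sum_smul_sq_le Finset.univ (fun i => bump r (z i).1 x₀) hb (fun i => (z i).2)
    have hE2 : 2 * E = ∑ i : Fin (N + 1), bump r (z i).1 x₀ * ‖(z i).2‖ ^ 2 := by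
      rw [hE, Finset.mul_sum]; refine Finset.sum_congr rfl fun i _ => ?_; ring
    rw [hE2]; exact this
  rcases hBnn.eq_or_lt with hB0 | hBpos
  · -- empty pool: every weight vanishes, all three moments are 0 and θ is the junk value 0
    have hall : ∀ i ∈ (Finset.univ : Finset (Fin (N + 1))), bump r (z i).1 x₀ = 0 :=
      (Finset.sum_eq_zero_iff_of_nonneg hb).1 hB0.symm
    have hE0 : E = 0 := Finset.sum_eq_zero fun i hi => by rw [hall i hi, zero_mul]
    have hP0 : P = 0 := Finset.sum_eq_zero fun i hi => by rw [hall i hi, zero_smul]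
    rw [hE0, hP0]
    simp
  · have hdiv : c * E / (c * B) = E / B := mul_div_mul_left E B hcpos.ne'
    have hvel : ‖(c * B)⁻¹ • (c • P)‖ ^ 2 = ‖P‖ ^ 2 / B ^ 2 := by
      rw [smul_smul, norm_smul, Real.norm_eq_abs, mul_pow, sq_abs]
      field_simp
    rw [hdiv, hvel]
    have key : ‖P‖ ^ 2 / B ^ 2 / 2 ≤ E / B := by
      rw [div_div, div_le_div_iff₀ (by positivity) hBpos]
      nlinarith [hCS, hBpos]
    linarith

/-- **Cold-pool junk value**: at `θ = 0` the Maxwellian of `maxwellDefect` is `0` (`(2π·0)^{-3/2} = 0` by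
`Real.zero_rpow`, `exp (−‖v − u‖²/0) = 1`), not a Dirac mass at `u`; the defect's integrand is then `poolTest F`
itself. [folklore] -/
theorem localMaxwellian_one_zero (u v : V3) : localMaxwellian 1 0 u v = 0 := by
  unfold localMaxwellian
  have h3 : (Module.finrank ℝ V3 : ℝ) = 3 := by simp
  rw [h3, mul_zero, Real.zero_rpow (by norm_num)]
  simp

end Summit.AtomisticToContinuum.HydrodynamicLimit.Theorems.PercolationClosesChaos.Negative
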